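import Literature.NumberTheory.PAdicHodge.BmaxPlusTDivisibilityIteration
import Literature.NumberTheory.PAdicHodge.AinfFrobeniusXiEigen
import Literature.NumberTheory.PAdicHodge.BmaxPlusFontaineKernel
import HarnessLib

/-!
# Colmez's `t`-divisibility on `A_max` and Fontaine's lemma `(A_max)^{φ=p} ∩ ker θ = ℤ_p · t/p` (for `p` odd)

Topic `Literature/NumberTheory/PAdicHodge`; namespace `Literature.NumberTheory.PAdicHodge`. THEOREMS ONLY (no definition, no named
fact, no instance, no `sorry`). On Colmez's integral crystalline ring `A_max = B_max⁺(F)` (`BmaxPlus`, `p`-adic completion of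
`B⁰_max = 𝔸_inf[ξ/p]`; `φ = frobBmaxPlus`, `θ = thetaBmaxPlus`, `t = log[ε] = tBmax`, `ι : 𝔸_inf → A_max`):

* ★★★ `exists_sq_mul_eq_zpToAinf_mul_tBmax` — **FONTAINE'S LEMMA, integral form: if `x ∈ A_max` satisfies `φ(x) = p·x` and `θ(x) = 0`
  then `p²·x = ι(λ)·t` for some `λ ∈ ℤ_p`** (`p ≠ 2`). In particular every such `x` is a `ℚ_p`-multiple of `t` — the injectivity half of the
  fundamental exact sequence `0 → ℚ_p·t → (B_cris⁺)^{φ=p} → ℂ_p → 0` (Fontaine, Th. 5.3.7; Colmez's criterion `x ∈ t·B_max⁺ ⇔ θ(φⁿx) = 0 ∀n`).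
* ★★ `tDivisibility` — the statement (TDIV) in the form consumed by `BmaxPlusFontaineKernel.fontaineKernel_of_tBmax_dvd`:
  `φx = px ∧ θx = 0 ⇒ ∃ k q, pᵏ·x = t·q` (here `k = 2`), and the resulting characterisation
  `frobBmaxPlus_eq_p_mul_and_theta_eq_zero_iff` of `ℚ_p·t ∩ A_max`.

Proof (no `B_cris`, no divided powers): write `x = (ξ/p)·z` (`ker θ|_{A_max} = (ξ/p)`), `t = ι([ε]−1)·v` with `v ∈ A_maxˣ` (`p` odd,
`BmaxPlusTUnit`) and `y = z/v`; then `φ(y) = ι(ξφ(c))·y` where `ω = ξ·c` is Fontaine's generator of `ker θ`. By `BmaxPlusTDivisibilityIteration`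
(division along the points `θ∘φʲ`, `j ≥ 1`, with summable loss `[p♭^{1/pʲ}]`, then `φⁿ` and `⋂ₙφⁿ(A_max) = ι(𝔸_inf)`), `p·y = ι(a)` with
`φ(a) = ξφ(c)·a` in `𝔸_inf`, and such `a` are exactly `ℤ_p·([ε]−1)/ξ` (`AinfFrobeniusXiEigen`). Unwinding, `p²·x = λ·t`.
This closes brick B7 of the φ-road of line `kato_lever` (crux K★ `stmt-BirchSwinnertonDyer-22226`; memos
`Cruxes/StarredOptimalManinUnitFiveSeven/Lines/kato-lever-K2-phi-road.md`, `…-fontaine-lemma.md`, `…-fontaine-lemma-g24.md` §1, where (TDIV) was the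
one research residue). Infrastructure only: BSD / K★ are not proved by any of this; K★ stays open ⟸ {P1-bar, [REC-tower]}.

## References
* [FontaineAsterisque223III] J.-M. Fontaine, *Le corps des périodes p-adiques*, Astérisque 223 (1994), Exp. III Th. 5.3.7
  (`Fil¹B_cris⁺ ∩ (B_cris⁺)^{φ=p} = ℚ_p·t`).
* [Colmez1998Annals] P. Colmez, *Théorie d'Iwasawa des représentations de de Rham d'un corps local*, Ann. of Math. 148 (1998), §III.2–III.3
  (`A_max`, `B_max⁺`, `t`-divisibility via the points `θ∘φⁿ`).
-/

noncomputable section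

open WittVector Field ValuativeRel Polynomial Finset
open Literature.AlgebraicGeometry.Resolution

namespace Literature.NumberTheory.PAdicHodge

open Literature.NumberTheory.GaloisRepresentations
open Literature.NumberTheory.GaloisRepresentations.IsNonarchimedeanLocalField

variable {F : Type} [Field F] [ValuativeRel F] [TopologicalSpace F] [IsNonarchimedeanLocalField F]
  [CharZero F] {p : ℕ} [Fact p.Prime] [Fact (¬ IsUnit (p : integerC F))]
  [IsAdicComplete (Ideal.span {(p : integerC F)}) (integerC F)]

/-! ### The reduction `x ↦ y = x/((ξ/p)·v)` -/

set_option maxHeartbeats 1600000 in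
/-- **The reduction.** If `φ(x) = p·x`, `x = (ξ/p)·z`, `t = ι(u)·v` with `v·w = 1`, and `ω = ξ·c`, then `y = z·w` satisfies
**`φ(y) = ι(ξ·φ(c))·y`**: from `ι(φξ)·φ(z) = p·ι(ξ)·z` (apply `φ` to `p·x = ι(ξ)·z`), `ι(φω)·φ(v) = p·v` (`BmaxPlusTUnit`) and `φ(ω) = φ(ξ)φ(c)`.
[cite: Colmez1998Annals, §III.3] -/
theorem frobBmaxPlus_eq_of_reduction (hF : Function.Surjective (fontaineTheta (integerC F) p)) {x z v w : BmaxPlus F p}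
    (hx : frobBmaxPlus F p x = (p : BmaxPlus F p) * x) (hz : x = algebraMap (bmaxZero F p) (BmaxPlus F p) omegaB * z)
    (hvt : tBmax (F := F) (p := p) = ainfToBmaxPlus F p uAinf * v) (hvw : v * w = 1)
    {c : Ainf (p := p) F} (hc : omega = xi * c) :
    frobBmaxPlus F p (z * w) = ainfToBmaxPlus F p (xi * WittVector.frobenius c) * (z * w) := by
  -- (A) `ι(φξ)·φ(z) = p·ι(ξ)·z`
  have hA : ainfToBmaxPlus F p (WittVector.frobenius xi) * frobBmaxPlus F p z =
      (p : BmaxPlus F p) * ainfToBmaxPlus F p xi * z := by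
    have e1 : (p : BmaxPlus F p) * frobBmaxPlus F p x = (p : BmaxPlus F p) * ((p : BmaxPlus F p) * x) := by rw [hx]
    have e2 : (p : BmaxPlus F p) * frobBmaxPlus F p x = ainfToBmaxPlus F p (WittVector.frobenius xi) * frobBmaxPlus F p z := by
      rw [hz, map_mul, ← mul_assoc, ← map_natCast (frobBmaxPlus F p) p, ← map_mul, ← ainfToBmaxPlus_xi, frobBmaxPlus_ainfToBmaxPlus]
    rw [← e2, e1, hz, ainfToBmaxPlus_xi]; ring
  -- (B) `ι(φω)·φ(v) = p·v`, (C) `φω = φξ·φc`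
  have hB := frobenius_omega_mul_frobBmaxPlus_eq_of_tBmax_eq hF hvt
  rw [hc, map_mul, map_mul] at hB
  -- combine: `p·v·(φ(zw) − ι(ξφc)·zw) = 0`
  have key : (p : BmaxPlus F p) * (v * (frobBmaxPlus F p (z * w) - ainfToBmaxPlus F p (xi * WittVector.frobenius c) * (z * w))) = 0 := by
    have hzvw : z = z * w * v := by rw [mul_assoc, mul_comm w, hvw, mul_one]
    have hA' := hA
    rw [hzvw, map_mul (frobBmaxPlus F p) (z * w) v] at hA'
    rw [map_mul (ainfToBmaxPlus F p)]
    linear_combination (ainfToBmaxPlus F p (WittVector.frobenius c)) * hA' - (frobBmaxPlus F p (z * w)) * hB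
  have h1 := eq_zero_of_natCast_mul_eq_zero' hF key
  rw [← sub_eq_zero]
  calc frobBmaxPlus F p (z * w) - ainfToBmaxPlus F p (xi * WittVector.frobenius c) * (z * w)
      = (v * w) * (frobBmaxPlus F p (z * w) - ainfToBmaxPlus F p (xi * WittVector.frobenius c) * (z * w)) := by rw [hvw, one_mul]
    _ = w * (v * (frobBmaxPlus F p (z * w) - ainfToBmaxPlus F p (xi * WittVector.frobenius c) * (z * w))) := by ring
    _ = 0 := by rw [h1, mul_zero]

/-! ### Fontaine's lemma -/

set_option maxHeartbeats 1600000 in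
/-- ★★★ **Fontaine's lemma on `A_max`, integral form (`p` odd)**: if `x ∈ A_max = B_max⁺(F)` satisfies `φ(x) = p·x` and `θ(x) = 0`, then
**`p²·x = ι(λ)·t`** for some `λ ∈ ℤ_p` (`t = log[ε]`). Equivalently `(A_max)^{φ=p} ∩ ker θ = ℤ_p·t/p` (the `t/p` of `BmaxPlusTDivP`), and
`(B_max⁺)^{φ=p} ∩ ker θ = ℚ_p·t` — the injectivity half of the fundamental exact sequence. [cite: FontaineAsterisque223III, Exp. III Th. 5.3.7]
[cite: Colmez1998Annals, §III.3] -/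
theorem exists_sq_mul_eq_zpToAinf_mul_tBmax (hF : Function.Surjective (fontaineTheta (integerC F) p)) (hp : p ≠ 2)
    {x : BmaxPlus F p} (hx : frobBmaxPlus F p x = (p : BmaxPlus F p) * x) (hθ : thetaBmaxPlus F p x = 0) :
    ∃ lam : ℤ_[p], (p : BmaxPlus F p) ^ 2 * x = ainfToBmaxPlus F p (zpToAinf lam) * tBmax := by
  obtain ⟨z, hz⟩ := exists_eq_omegaB_mul_of_thetaBmaxPlus_eq_zero hF hθ
  obtain ⟨v, hvu, hvt⟩ := exists_isUnit_tBmax_eq_uAinf_mul (F := F) (p := p) hp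
  obtain ⟨w, hvw⟩ := hvu.exists_right_inv
  obtain ⟨c, hc, -⟩ := exists_omega_eq_xi_mul (F := F) (p := p)
  have hy := frobBmaxPlus_eq_of_reduction hF hx hz hvt hvw hc
  obtain ⟨a, ha, hφa⟩ := exists_eq_ainfToBmaxPlus_of_frobBmaxPlus_eq hF hc hy
  obtain ⟨lam, hlam⟩ := exists_eq_zpToAinf_mul_uDivXi_of_frobenius_eq hc hφa
  refine ⟨lam, ?_⟩
  -- unwind: `p²x = p·(ξ/p)·v·(p·zw) = (ξ/p)·v·p·ι(λ·u/ξ)` and `t = ι(ξ·u/ξ)·v = p·(ξ/p)·ι(u/ξ)·v`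
  have ht : tBmax (F := F) (p := p) =
      (p : BmaxPlus F p) * algebraMap (bmaxZero F p) (BmaxPlus F p) omegaB * ainfToBmaxPlus F p uDivXi * v := by
    rw [hvt, ← xi_mul_uDivXi, map_mul, ainfToBmaxPlus_xi]
  have hzy : z = z * w * v := by rw [mul_assoc, mul_comm w, hvw, mul_one]
  rw [hlam, map_mul] at ha
  calc (p : BmaxPlus F p) ^ 2 * x
      = (p : BmaxPlus F p) * algebraMap (bmaxZero F p) (BmaxPlus F p) omegaB * v * ((p : BmaxPlus F p) * (z * w)) := by
        rw [hz]; conv_lhs => rw [hzy]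
        ring
    _ = ainfToBmaxPlus F p (zpToAinf lam) * tBmax := by rw [ha, ht]; ring

/-- ★★ **(TDIV) Colmez's `t`-divisibility for eigenvectors, in the form consumed by `fontaineKernel_of_tBmax_dvd`** (`p` odd):
every `x ∈ A_max` with `φ(x) = p·x` and `θ(x) = 0` has `pᵏ·x ∈ t·A_max` for some `k` (indeed `k = 2`). [cite: Colmez1998Annals, §III.3] -/
theorem tDivisibility (hF : Function.Surjective (fontaineTheta (integerC F) p)) (hp : p ≠ 2) :
    ∀ x : BmaxPlus F p, frobBmaxPlus F p x = (p : BmaxPlus F p) * x → thetaBmaxPlus F p x = 0 →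
      ∃ (k : ℕ) (q : BmaxPlus F p), (p : BmaxPlus F p) ^ k * x = tBmax * q := by
  intro x hx hθ
  obtain ⟨lam, h⟩ := exists_sq_mul_eq_zpToAinf_mul_tBmax hF hp hx hθ
  exact ⟨2, ainfToBmaxPlus F p (zpToAinf lam), by rw [h, mul_comm]⟩

/-- ★★ **Fontaine's lemma through the tree's assembly `fontaineKernel_of_tBmax_dvd`** (edix-p4): `φ(x) = p·x ∧ θ(x) = 0 ⇒ pᵏx = ι(c)·t`,
now unconditional for `p` odd. [cite: FontaineAsterisque223III, Exp. III Th. 5.3.7] -/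
theorem fontaineKernel (hF : Function.Surjective (fontaineTheta (integerC F) p)) (hp : p ≠ 2)
    {x : BmaxPlus F p} (hx : frobBmaxPlus F p x = (p : BmaxPlus F p) * x) (hθ : thetaBmaxPlus F p x = 0) :
    ∃ (k : ℕ) (c : ℤ_[p]), (p : BmaxPlus F p) ^ k * x = ainfToBmaxPlus F p (zpToAinf c) * tBmax :=
  fontaineKernel_of_tBmax_dvd hF (tDivisibility hF hp) hx hθ

/-- ★★ **`ℚ_p·t ∩ A_max` characterised (`p` odd)**: `φ(x) = p·x ∧ θ(x) = 0 ↔ ∃ k c, pᵏ·x = ι(c)·t`.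
[cite: FontaineAsterisque223III, Exp. III Th. 5.3.7] [cite: Colmez1998Annals, §III.3] -/
theorem frobBmaxPlus_eq_p_mul_and_theta_eq_zero_iff (hF : Function.Surjective (fontaineTheta (integerC F) p)) (hp : p ≠ 2)
    (x : BmaxPlus F p) :
    (frobBmaxPlus F p x = (p : BmaxPlus F p) * x ∧ thetaBmaxPlus F p x = 0) ↔
      ∃ (k : ℕ) (c : ℤ_[p]), (p : BmaxPlus F p) ^ k * x = ainfToBmaxPlus F p (zpToAinf c) * tBmax :=
  frobBmaxPlus_eq_p_mul_and_theta_eq_zero_iff_of_tBmax_dvd hF (tDivisibility hF hp) x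

end Literature.NumberTheory.PAdicHodge

end
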